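import Summits.NavierStokesRegularity.NavierStokesRegularity.Theorems.StrainDoorsNearRecordLawPeak
import HarnessLib

/-!
# Strain doors, PART L — the near-record stretching law on the original solution (ROUND 60 of the

(Tree file 2 of 2 of PART L — §L3 (the laws on the original solution); §L1–§L2 (stretching = geometry on the peak class, cap ⟺ geometric ceiling, near-record extraction) are in `StrainDoorsNearRecordLawPeak`.
Text of nsreg-p1 g35 r60/StrainDoorsNearRecordLaw.lean sha256 8b224fcf95c71fb9, split at the 400-line cap at a § boundary,
bodies verbatim.)
ns-regularity-ideate cell)

PARTS H–K moved the record law to the TANGENT field of a Type-I solution.  This file pulls it back to the ORIGINAL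
solution, uniformly over the Type-I class with one constant `C₀`, with NO limit object in the statements:

* §L1 on the Type-I tangent peak class the stretching rate at the peak is a function of the GEOMETRY of the
  vorticity there (record identity, PART J): the dynamic door «PeakStretchingCap κ» of PART K is EQUIVALENT to the
  geometric ceiling «twist + scale-free concavity `< κ`» (`peakStretchingCap_iff_geometric_ceiling`);
* §L2 the NEAR-RECORD EXTRACTION lemma: from points of Type-I solutions whose scale-invariant vorticity comes within
  `δ_j → 0` of an upper bound `W_j ≥ w₀ > 0` of the vorticity number one extracts a member of the peak class with
  `ρ̄ ≥ w₀` along which the scale-invariant STRETCHING RATES converge (`typeI_nearRecord_extraction`; PARTS G, H);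
* §L3 laws ON `u` ITSELF: the near-record stretching FLOOR `(0 − t)⟪ξ,∇u ξ⟫ ≥ 1 − ε` (`typeI_nearRecord_stretching`),
  the near-record stretching PINCH `≤ 1 + K₃(C₀)/w₀ + ε` (`typeI_nearRecord_stretching_pinch`), near-critical
  stretching points exist in every non-trivial Type-I ancient solution (`typeI_exists_nearCritical_stretching`), and
  the Liouville theorem under a uniform stretching cap (`eq_zero_of_typeI_of_stretching_le`), which needs the cap
  on the NEAR-RECORD set only (`eq_zero_of_typeI_of_nearRecord_stretching_cap`).

References: Koch–Nadirashvili–Seregin–Šverák, Acta Math. 203 (2009), Lemma 3.1, §4 (4.11) [KNSS2009];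
Constantin–Fefferman, Indiana Univ. Math. J. 42 (1993); Beale–Kato–Majda, Comm. Math. Phys. 94 (1984).
-/

noncomputable section

open MeasureTheory Set Function Filter Metric Real InnerProductSpace
open _root_.Topology
open scoped ENNReal NNReal RealInnerProductSpace ContDiff Laplacian
open Literature.Analysis Literature.Analysis.FluidPDE
open Literature.Analysis.FluidPDE.VorticityDirectionDynamics

set_option linter.unusedVariables false
set_option linter.unusedSectionVars false

namespace Summit.NavierStokesRegularity.NavierStokesRegularity.Theorems.StrainDoors

open Summit.NavierStokesRegularity.NavierStokesRegularity.Theorems.ArgmaxDoors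

/-! ## §L3 Laws on the original solution -/

/-- ★★★ **THE NEAR-RECORD STRETCHING FLOOR ON `u` ITSELF (uniform in the Type-I class; no limit object in the
statement).**  For all `C₀`, `w₀ > 0`, `ε > 0` there is `δ > 0` such that: for every classical solution `(u,p)` of
Navier–Stokes (`ν = 1`, `f = 0`) on `(−∞,0) × ℝ³` with `|u(t,x)| ≤ C₀/(|x| + √(−t))`, every upper bound `W ≥ w₀` of its
vorticity number (`(0 − s)|ω(s,y)| ≤ W` for all `s < 0`, `y`), and every space-time point `(t,x)` where the
number comes within `δ` of `W`, `(0 − t)|ω(t,x)| ≥ W − δ`, the vortex-stretching rate along the vorticity direction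
obeys `(0 − t)·⟪ξ(t,x), ∇u(t,x) ξ(t,x)⟫ ≥ 1 − ε`.  (Contradiction + §L2 + the record law at the extracted peak.)
[new-as-typed] -/
theorem typeI_nearRecord_stretching (C₀ w₀ ε : ℝ) (hw₀ : 0 < w₀) (hε : 0 < ε) :
    ∃ δ : ℝ, 0 < δ ∧
      ∀ (u : ℝ → (EuclideanSpace ℝ (Fin 3)) → (EuclideanSpace ℝ (Fin 3))) (p : ℝ → (EuclideanSpace ℝ (Fin 3)) → ℝ)
        (W t : ℝ) (x : EuclideanSpace ℝ (Fin 3)),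
        IsClassicalNSSolutionOn (Iio 0) 1 0 u p → HasTypeIDecay C₀ u →
        (∀ s : ℝ, s < 0 → ∀ y, (0 - s) * ‖curl (u s) y‖ ≤ W) → w₀ ≤ W → t < 0 →
        W - δ ≤ (0 - t) * ‖curl (u t) x‖ →
        1 - ε ≤ (0 - t) * ⟪vorticityDirection (curl (u t)) x,
          fderiv ℝ (u t) x (vorticityDirection (curl (u t)) x)⟫ := by
  by_contra H
  push Not at H
  have Hj := fun j : ℕ => H (w₀ / ((j : ℝ) + 2)) (by positivity)
  choose u p W t x hsol hI hdom hW ht hnear hbad using Hj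
  have hδ1 : ∀ j : ℕ, w₀ / ((j : ℝ) + 2) ≤ w₀ / 2 := fun j =>
    div_le_div_of_nonneg_left hw₀.le (by norm_num) (by linarith [(Nat.cast_nonneg j : (0:ℝ) ≤ j)])
  have hδ : Tendsto (fun j : ℕ => w₀ / ((j : ℝ) + 2)) atTop (𝓝 0) :=
    tendsto_const_nhds.div_atTop (tendsto_atTop_add_const_right _ _ tendsto_natCast_atTop_atTop)
  obtain ⟨v, zbar, hP, hw, θ, hθ, hconv⟩ :=
    typeI_nearRecord_extraction hw₀ hsol hI hdom hW ht hnear hδ1 hδ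
  -- the record law at the extracted peak
  obtain ⟨-, -, hlap, hid, -, -⟩ := hP.record_identity
  have hρ : 0 < ‖curl (v (-1)) zbar‖ := by linarith
  have hF := frobeniusNormSq_nonneg (fderiv ℝ (vorticityDirection (curl (v (-1)))) zbar)
  have hq : 0 ≤ (0 - (-1)) * (-(Δ fun y => ‖curl (v (-1)) y‖) zbar) / ‖curl (v (-1)) zbar‖ :=
    div_nonneg (by linarith [hlap]) hρ.le
  have hlaw : 1 ≤ (0 - (-1)) * ⟪vorticityDirection (curl (v (-1))) zbar,
      fderiv ℝ (v (-1)) zbar (vorticityDirection (curl (v (-1))) zbar)⟫ := by nlinarith [hid, hF, hq]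
  -- but the stretching rates at the bad points stay below `1 - ε`
  have hle := le_of_tendsto' hconv fun j => (hbad (θ j)).le
  linarith

/-- ★★ **THE NEAR-RECORD STRETCHING PINCH ON `u` ITSELF.**  With the uniform third-derivative constant `K₃(C₀)` of
PART J (KNSS (4.11) on tangent fields): for all `w₀ > 0`, `ε > 0` there is `δ > 0` such that at every space-time
point of every classical Type-I solution (constant `C₀`) where the scale-invariant vorticity comes within `δ` of an
upper bound `W ≥ w₀` of the vorticity number, `(0 − t)·⟪ξ, ∇u ξ⟫(t,x) ≤ 1 + K₃(C₀)/w₀ + ε`.  So near records the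
stretching rate is PINCHED in `[ (1 − ε)/(0 − t), (1 + K₃/w₀ + ε)/(0 − t) ]`. [new-as-typed] -/
theorem typeI_nearRecord_stretching_pinch (C₀ : ℝ) : ∃ K₃ : ℝ, 0 ≤ K₃ ∧ ∀ (w₀ ε : ℝ), 0 < w₀ → 0 < ε →
    ∃ δ : ℝ, 0 < δ ∧
      ∀ (u : ℝ → (EuclideanSpace ℝ (Fin 3)) → (EuclideanSpace ℝ (Fin 3))) (p : ℝ → (EuclideanSpace ℝ (Fin 3)) → ℝ)
        (W t : ℝ) (x : EuclideanSpace ℝ (Fin 3)),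
        IsClassicalNSSolutionOn (Iio 0) 1 0 u p → HasTypeIDecay C₀ u →
        (∀ s : ℝ, s < 0 → ∀ y, (0 - s) * ‖curl (u s) y‖ ≤ W) → w₀ ≤ W → t < 0 →
        W - δ ≤ (0 - t) * ‖curl (u t) x‖ →
        (0 - t) * ⟪vorticityDirection (curl (u t)) x,
          fderiv ℝ (u t) x (vorticityDirection (curl (u t)) x)⟫ ≤ 1 + K₃ / w₀ + ε := by
  obtain ⟨K₃, hK₃, hK⟩ := tangent_laplacian_curl_bound C₀
  refine ⟨K₃, hK₃, fun w₀ ε hw₀ hε => ?_⟩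
  by_contra H
  push Not at H
  have Hj := fun j : ℕ => H (w₀ / ((j : ℝ) + 2)) (by positivity)
  choose u p W t x hsol hI hdom hW ht hnear hbad using Hj
  have hδ1 : ∀ j : ℕ, w₀ / ((j : ℝ) + 2) ≤ w₀ / 2 := fun j =>
    div_le_div_of_nonneg_left hw₀.le (by norm_num) (by linarith [(Nat.cast_nonneg j : (0:ℝ) ≤ j)])
  have hδ : Tendsto (fun j : ℕ => w₀ / ((j : ℝ) + 2)) atTop (𝓝 0) :=
    tendsto_const_nhds.div_atTop (tendsto_atTop_add_const_right _ _ tendsto_natCast_atTop_atTop)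
  obtain ⟨v, zbar, hP, hw, θ, hθ, hconv⟩ :=
    typeI_nearRecord_extraction hw₀ hsol hI hdom hW ht hnear hδ1 hδ
  -- the record identity at the extracted peak, read upwards, and the uniform bound on `Δω`
  obtain ⟨-, -, -, -, hid', -⟩ := hP.record_identity
  obtain ⟨hvc, hvI, hweak, hne, -⟩ := hP
  have hρ : 0 < ‖curl (v (-1)) zbar‖ := by linarith
  have hΔ : ‖(Δ (curl (v (-1)))) zbar‖ ≤ K₃ := hK hvc hvI hweak (-1) (by norm_num) zbar
  have hξ : ‖vorticityDirection (curl (v (-1))) zbar‖ = 1 := norm_vorticityDirection _ hne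
  have hcs : -⟪vorticityDirection (curl (v (-1))) zbar, (Δ (curl (v (-1)))) zbar⟫ ≤ K₃ := by
    have h := abs_real_inner_le_norm (vorticityDirection (curl (v (-1))) zbar) ((Δ (curl (v (-1)))) zbar)
    rw [hξ, one_mul] at h
    linarith [(abs_le.mp h).1, hΔ]
  have hup : (0 - (-1)) * ⟪vorticityDirection (curl (v (-1))) zbar,
      fderiv ℝ (v (-1)) zbar (vorticityDirection (curl (v (-1))) zbar)⟫ ≤ 1 + K₃ / w₀ := by
    have h1 : (0 - (-1)) * (-⟪vorticityDirection (curl (v (-1))) zbar, (Δ (curl (v (-1)))) zbar⟫) /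
        ‖curl (v (-1)) zbar‖ ≤ K₃ / ‖curl (v (-1)) zbar‖ := by
      rw [div_le_div_iff_of_pos_right hρ]; linarith
    have h2 : K₃ / ‖curl (v (-1)) zbar‖ ≤ K₃ / w₀ := div_le_div_of_nonneg_left hK₃ hw₀ hw
    linarith [hid', h1, h2]
  -- but the stretching rates at the bad points stay above `1 + K₃/w₀ + ε`
  have hge := ge_of_tendsto' hconv fun j => (hbad (θ j)).le
  linarith

/-- ★★ **EVERY NON-TRIVIAL TYPE-I ANCIENT SOLUTION HAS NEAR-CRITICAL STRETCHING POINTS.**  If `(u,p)` is a classical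
Type-I solution on `(−∞,0) × ℝ³` with `ω ≢ 0`, then for every `ε > 0` there is a space-time point `(t,x)`, `t < 0`,
with `ω(t,x) ≠ 0` and `(0 − t)·⟪ξ, ∇u ξ⟫(t,x) ≥ 1 − ε` (apply the floor with `W = w₀ =` the vorticity number
`N = sup (0 − s)|ω|`, finite by PART G, and a point where the sup is `δ`-approached). [new-as-typed] -/
theorem typeI_exists_nearCritical_stretching {C₀ : ℝ}
    {u : ℝ → (EuclideanSpace ℝ (Fin 3)) → (EuclideanSpace ℝ (Fin 3))} {p : ℝ → (EuclideanSpace ℝ (Fin 3)) → ℝ}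
    (hsol : IsClassicalNSSolutionOn (Iio 0) 1 0 u p) (hI : HasTypeIDecay C₀ u)
    (hcurl : ∃ t₀ : ℝ, t₀ < 0 ∧ ∃ x₀, curl (u t₀) x₀ ≠ 0) {ε : ℝ} (hε : 0 < ε) :
    ∃ t : ℝ, t < 0 ∧ ∃ x : EuclideanSpace ℝ (Fin 3), curl (u t) x ≠ 0 ∧
      1 - ε ≤ (0 - t) * ⟪vorticityDirection (curl (u t)) x,
        fderiv ℝ (u t) x (vorticityDirection (curl (u t)) x)⟫ := by
  have hC₀ : 0 ≤ C₀ := HasTypeIDecay.nonneg' hI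
  obtain ⟨t₀, ht₀, x₀, hx₀⟩ := hcurl
  obtain ⟨B, hB, hBb⟩ := typeI_vorticityNumber_bound hC₀
  -- the vorticity number `N = sup (0 - s)|ω(s,y)|`
  obtain ⟨S, hS⟩ : ∃ S : Set ℝ, S = {r | ∃ s : ℝ, s < 0 ∧ ∃ y : EuclideanSpace ℝ (Fin 3),
      r = (0 - s) * ‖curl (u s) y‖} := ⟨_, rfl⟩
  have hbdd : BddAbove S := ⟨B, fun r hr => by
    rw [hS] at hr; obtain ⟨s, hs, y, rfl⟩ := hr; exact hBb hsol hI s hs y⟩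
  have hmem : ∀ s : ℝ, s < 0 → ∀ y, (0 - s) * ‖curl (u s) y‖ ∈ S := fun s hs y => by
    rw [hS]; exact ⟨s, hs, y, rfl⟩
  have hN0 : 0 < sSup S := by
    have h1 : 0 < (0 - t₀) * ‖curl (u t₀) x₀‖ := mul_pos (by linarith) (norm_pos_iff.mpr hx₀)
    exact h1.trans_le (le_csSup hbdd (hmem t₀ ht₀ x₀))
  have hdom : ∀ s : ℝ, s < 0 → ∀ y, (0 - s) * ‖curl (u s) y‖ ≤ sSup S := fun s hs y =>
    le_csSup hbdd (hmem s hs y)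
  obtain ⟨δ, hδ, hlaw⟩ := typeI_nearRecord_stretching C₀ (sSup S) ε hN0 hε
  -- a point where the sup is approached within `min δ (N/2)`
  have hlt : sSup S - min δ (sSup S / 2) < sSup S := by
    have := lt_min hδ (half_pos hN0); linarith
  obtain ⟨r, hr, hrlt⟩ := exists_lt_of_lt_csSup ⟨_, hmem t₀ ht₀ x₀⟩ hlt
  rw [hS] at hr
  obtain ⟨t, ht, x, rfl⟩ := hr
  refine ⟨t, ht, x, ?_, hlaw u p (sSup S) t x hsol hI hdom le_rfl ht ?_⟩
  · intro h0
    rw [h0, norm_zero, mul_zero] at hrlt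
    have := min_le_right δ (sSup S / 2); linarith
  · have := min_le_left δ (sSup S / 2); linarith

/-- An irrotational classical Type-I slice vanishes: `curl u(t,·) ≡ 0` for all `t < 0` forces `u ≡ 0` (tree
`eq_of_curl_eq_zero_of_isDivFree_of_bounded` = KNSS Lemma 3.1: curl-free + div-free + bounded ⇒ constant; a constant
with Type-I spatial decay is `0`).  (Factored out of PART K's `eq_zero_of_typeI_of_peakClassEmpty`.) -/
theorem eq_zero_of_typeI_of_curl_eq_zero {C₀ : ℝ}
    {u : ℝ → (EuclideanSpace ℝ (Fin 3)) → (EuclideanSpace ℝ (Fin 3))} {p : ℝ → (EuclideanSpace ℝ (Fin 3)) → ℝ}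
    (hsol : IsClassicalNSSolutionOn (Iio 0) 1 0 u p) (hI : HasTypeIDecay C₀ u)
    (hcurl : ∀ t : ℝ, t < 0 → ∀ x : EuclideanSpace ℝ (Fin 3), curl (u t) x = 0) :
    ∀ t : ℝ, t < 0 → ∀ x : EuclideanSpace ℝ (Fin 3), u t x = 0 := by
  intro t ht x
  have hs : ContDiff ℝ 2 (u t) :=
    contDiff_infty.mp (hsol.smooth_velocity.contDiff_slice (mem_Iio.mpr ht)) 2
  have hsq : 0 < √(-t) := Real.sqrt_pos.mpr (neg_pos.mpr ht)
  have hC₀ : 0 ≤ C₀ := HasTypeIDecay.nonneg' hI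
  have hbd : ∀ y, ‖u t y‖ ≤ C₀ / √(-t) := fun y =>
    (hI t ht y).trans (div_le_div_of_nonneg_left hC₀ hsq (by linarith [norm_nonneg y]))
  have hconst :=
    eq_of_curl_eq_zero_of_isDivFree_of_bounded hs (hcurl t ht) (hsol.divFree t (mem_Iio.mpr ht)) hbd
  by_contra hx
  have hpos : 0 < ‖u t x‖ := norm_pos_iff.mpr hx
  obtain ⟨y, hy⟩ : ∃ y : EuclideanSpace ℝ (Fin 3), 2 * C₀ / ‖u t x‖ ≤ ‖y‖ := by
    obtain ⟨y, hy⟩ := NormedSpace.exists_lt_norm ℝ (EuclideanSpace ℝ (Fin 3)) (2 * C₀ / ‖u t x‖)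
    exact ⟨y, hy.le⟩
  have h1 : ‖u t x‖ ≤ C₀ / (‖y‖ + √(-t)) := by rw [hconst x y]; exact hI t ht y
  have hden : 0 < ‖y‖ + √(-t) := by linarith [norm_nonneg y]
  rw [le_div_iff₀ hden] at h1
  rw [div_le_iff₀ hpos] at hy
  nlinarith [h1, hy, hsq, hpos, norm_nonneg y, hC₀]

/-- ★★ **LIOUVILLE UNDER A UNIFORM STRETCHING CAP (on `u` itself).**  A classical Type-I solution on `(−∞,0) × ℝ³`
whose scale-invariant stretching rate stays uniformly subcritical wherever the vorticity is non-zero,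
`(0 − t)·⟪ξ, ∇u ξ⟫(t,x) ≤ 1 − ε` (`ε > 0` fixed), VANISHES IDENTICALLY.  (By the previous theorem there would be a
near-critical point; so `ω ≡ 0`; then curl-free Liouville.)  A sup-norm ODE proof of the vanishing of `ω` is
folklore for forward solutions (BKM-type); the point here is that it drops out of the near-record law with no
differential inequality for `‖ω(t)‖_∞`. [new-as-typed; folklore-adjacent] -/
theorem eq_zero_of_typeI_of_stretching_le {C₀ : ℝ}
    {u : ℝ → (EuclideanSpace ℝ (Fin 3)) → (EuclideanSpace ℝ (Fin 3))} {p : ℝ → (EuclideanSpace ℝ (Fin 3)) → ℝ}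
    (hsol : IsClassicalNSSolutionOn (Iio 0) 1 0 u p) (hI : HasTypeIDecay C₀ u) {ε : ℝ} (hε : 0 < ε)
    (hcap : ∀ t : ℝ, t < 0 → ∀ x : EuclideanSpace ℝ (Fin 3), curl (u t) x ≠ 0 →
      (0 - t) * ⟪vorticityDirection (curl (u t)) x,
        fderiv ℝ (u t) x (vorticityDirection (curl (u t)) x)⟫ ≤ 1 - ε) :
    ∀ t : ℝ, t < 0 → ∀ x : EuclideanSpace ℝ (Fin 3), u t x = 0 := by
  refine eq_zero_of_typeI_of_curl_eq_zero hsol hI ?_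
  by_contra hne
  push Not at hne
  obtain ⟨t₀, ht₀, x₀, hx₀⟩ := hne
  obtain ⟨t, ht, x, hx, hge⟩ :=
    typeI_exists_nearCritical_stretching hsol hI ⟨t₀, ht₀, x₀, hx₀⟩ (half_pos hε)
  have := hcap t ht x hx
  linarith

/-- ★★ **THE DOOR ON `u` ITSELF: A NEAR-RECORD STRETCHING CAP IS THE TYPE-I LIOUVILLE THEOREM.**  Let `(u,p)` be a
classical Type-I solution on `(−∞,0) × ℝ³` and `W` a SHARP upper bound of its vorticity number (`(0 − s)|ω| ≤ W`
everywhere and `(0 − s)|ω| > W − η` somewhere for every `η > 0`).  If for some `ε, δ > 0` the scale-invariant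
stretching rate is capped, `(0 − t)⟪ξ, ∇u ξ⟫(t,x) ≤ 1 − ε`, at every point where `(0 − t)|ω(t,x)| ≥ W − δ` (ONLY the
near-record points), then `u ≡ 0`.  So for Type-I Liouville it suffices to cap the stretching rate strictly below
the clock rate on the near-record set alone — the complement of the near-record FLOOR. [new-as-typed] -/
theorem eq_zero_of_typeI_of_nearRecord_stretching_cap {C₀ : ℝ}
    {u : ℝ → (EuclideanSpace ℝ (Fin 3)) → (EuclideanSpace ℝ (Fin 3))} {p : ℝ → (EuclideanSpace ℝ (Fin 3)) → ℝ}
    (hsol : IsClassicalNSSolutionOn (Iio 0) 1 0 u p) (hI : HasTypeIDecay C₀ u) {W : ℝ}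
    (hdom : ∀ s : ℝ, s < 0 → ∀ y, (0 - s) * ‖curl (u s) y‖ ≤ W)
    (hsharp : ∀ η : ℝ, 0 < η → ∃ s : ℝ, s < 0 ∧ ∃ y, W - η < (0 - s) * ‖curl (u s) y‖)
    {ε δ : ℝ} (hε : 0 < ε) (hδ : 0 < δ)
    (hcap : ∀ t : ℝ, t < 0 → ∀ x : EuclideanSpace ℝ (Fin 3), W - δ ≤ (0 - t) * ‖curl (u t) x‖ →
      (0 - t) * ⟪vorticityDirection (curl (u t)) x,
        fderiv ℝ (u t) x (vorticityDirection (curl (u t)) x)⟫ ≤ 1 - ε) :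
    ∀ t : ℝ, t < 0 → ∀ x : EuclideanSpace ℝ (Fin 3), u t x = 0 := by
  refine eq_zero_of_typeI_of_curl_eq_zero hsol hI ?_
  by_contra hne
  push Not at hne
  obtain ⟨t₀, ht₀, x₀, hx₀⟩ := hne
  have hW0 : 0 < W :=
    (mul_pos (by linarith) (norm_pos_iff.mpr hx₀)).trans_le (hdom t₀ ht₀ x₀)
  obtain ⟨δ₀, hδ₀, hlaw⟩ := typeI_nearRecord_stretching C₀ W (ε / 2) hW0 (half_pos hε)
  obtain ⟨t, ht, x, hx⟩ := hsharp (min δ δ₀) (lt_min hδ hδ₀)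
  have h1 : W - δ ≤ (0 - t) * ‖curl (u t) x‖ := by have := min_le_left δ δ₀; linarith
  have h2 : W - δ₀ ≤ (0 - t) * ‖curl (u t) x‖ := by have := min_le_right δ δ₀; linarith
  have hlo := hlaw u p W t x hsol hI hdom le_rfl ht h2
  have hhi := hcap t ht x h1
  linarith

end Summit.NavierStokesRegularity.NavierStokesRegularity.Theorems.StrainDoors
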